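import Literature.IUT.HodgeArakelov.LabelClassesOfCuspsCor24iGraphLevels
import HarnessLib

/-!
# [IUTchII] Cor 2.4 (i), inputs (B)+(C): the level predicates reduced to STATEMENTS ABOUT `Π_𝔾` (admissible tower adapter)

S. Mochizuki, *Inter-universal Teichmüller Theory II*, kurims manuscript (Dec. 2020), §2, Cor 2.4 (i), proof p.70 l.−2 –
p.71 l.4 ("to the various finite index open subgroups of `Δ^±_v` … `γ' ∈ Δ̂^±_{v□}` … hence `γ' ∈ Δ^±_{v□}`"); *… I*, kurims
manuscript (May 2020), §2 p.45 l.4–8 ("one may think of `Π^tp_ℍ` … as the decomposition subgroup in `Π^tp_𝔾` …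
associated to the sub-semi-graph `ℍ`"), Cor 2.3 (i)/(ii)/(v)/(vi) pp.47–48; *Semi-graphs of anabelioids*, Publ. RIMS
**42** (2006), §2, proof of Cor 2.7 (i) p.30 (components of the inverse image of `ℍ` in a finite étale covering of `𝒢` ↔
double cosets `Π_ℍ \ Π_𝒢 / Π'`) [cite: Mochizuki2012, II Cor 2.4 (i) pp.70-71] (D-0012 claim key, status disputed;
PROOF-ONLY — no definition, nothing of the series asserted; abc-iut cell, seat abc-iut-w5-d121; node `IUTchII:Cor2.4(i)`
inputs (B)/(C), GAP-LEDGER G-w4d012-2; sub-DAG `plan/L5/SUBDAG-IUTchI-Cor23Levels.md`, rows B1 (c) / B4 / B5).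

WHAT IT ADDS to `LabelClassesOfCuspsCor24iGraphLevels` (p420922: (B)+(C) from ADMISSIBLE levels, closure taken in `Π̂_𝔾`).
When the tower IS admissible — the level `Ĵ_i ∩ Δ̂_X` is the inverse image under `ρ̂ : Δ̂_X ↠ Π̂_𝔾` of an open normal
subgroup `V_i ⊆ Π̂_𝔾` (hypothesis `hJhat`) — the inputs of abc-iut-L5-t11's carrier that are NOT "Cor 2.3 (vi) by name"
become statements about the semi-graph of anabelioids `𝔾` ALONE (abc-iut-L3's vocabulary):
* `Prop24Tower.levelsNormal_of_graphLevels` — `LevelsNormal` ⇐ `V_i ⊴ Π̂_𝔾`;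
* `Prop24Tower.mem_levelTp_iff_of_graphLevels` — `d ∈ J_i ↔ ι(ρ^tp d) ∈ V_i` (the compatibility `ρ̂ ∘ ι_Δ = ι ∘ ρ^tp`);
* `Prop24Tower.images_shrink_of_graphLevels` — the consumer's `hU` ⇐ the `V_i` shrink to `1` in `Π̂_𝔾` (profiniteness);
* `SubgraphLevelData.stabLeDeltaHLevel_of_graphLevels` — the dictionary row B1 (c) ⇐ its `Π_𝔾`-form **(D3)** "an element
  of `Π^tp_X` stabilising `ℍ̃_i` maps into `Π̂_ℍ · V_i`" (stabiliser of a component of `p_i⁻¹(ℍ)` for the Galois covering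
  `𝔾_i → 𝔾` with group `Π̂_𝔾/V_i`, [SemiAnbd] Cor 2.7 (i) proof — abc-iut-L3 row D3/D3b) + "`Π̂_ℍ` lies in the closure of
  `ι(Π^tp_ℍ)`" (the density behind [IUTchI] Cor 2.3 (ii)) + `V_i` open (an open coset meeting the closure meets the set);
* § 2 **`StableCurveAgreement.mem_deltaPmBox_of_graphTower`** and the closers **`cor24_i'_of_graphTower_byName`** /
  **`cor24_ii_iii'_of_graphTower_byName`**: the decls of record `Cor24_i'` / `Cor24_ii_iii'` with input (B)+(C) resting on
  [IUTchI] Cor 2.3 (v) (`Cor23v`) + Cor 2.3 (vi) for the admissible level data (`Cor23vi`) BY NAME, and otherwise ONLY on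
  `Π_𝔾`-level statements: `V_i ⊴ Π̂_𝔾` open, shrinking to `1`; (D3) stabilisers; density of `Π^tp_ℍ` in `Π̂_ℍ`; `Π̂_ℍ` closed
  — plus the agreements/dictionaries and tower placement (`hlevV`, `hinf`).
PROVED (kernel); every [IUTchI]/[IUTchII]/[SemiAnbd] statement is a HYPOTHESIS; typed ≠ proved; nothing here bears on
[IUTchIII] Cor 3.12.
-/

universe u

/-! ## § 1. The carrier's level predicates from `Π_𝔾`-level statements -/

namespace Literature.IUT.HodgeTheaters

open Topology
open scoped Pointwise

namespace StableCurveTemperedData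

variable {D : StableCurveTemperedData.{u}}

namespace Prop24Tower

variable (T : D.Prop24Tower)

/-- **IUTchI:Prop2.4(i)** (kurims p.50 l.27 "characteristic open subgroups") For an ADMISSIBLE tower — `Ĵ_i ∩ Δ̂_X =
ρ̂⁻¹(V_i)` — normality of the levels in `Δ̂_X` follows from `V_i ⊴ Π̂_𝔾`. PROVED. [claim: Mochizuki2012, status: disputed] -/
theorem levelsNormal_of_graphLevels (V : T.I → Subgroup D.graph.Hat)
    (hJhat : ∀ i (y : D.DeltaHat), (y : D.PiHat) ∈ T.Jhat i ↔ D.ρHat y ∈ V i) (hVn : ∀ i, (V i).Normal) :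
    T.LevelsNormal := by
  intro i
  refine ⟨fun n hn g => ?_⟩
  have hn' : D.ρHat n ∈ V i := (hJhat i n).mp hn
  show ((g * n * g⁻¹ : D.DeltaHat) : D.PiHat) ∈ T.Jhat i
  rw [hJhat, map_mul, map_mul, map_inv]
  exact (hVn i).conj_mem _ hn' _

/-- **IUTchI:Cor2.3** (kurims p.47, compatibility `Π^tp_𝔾 ↪ Π̂_𝔾` vs `Δ^tp_X ↪ Δ̂_X`) For an admissible tower the TEMPERED
level is `J_i = {d ∈ Δ^tp_X | ι(ρ^tp d) ∈ V_i}`. PROVED (`ρ̂ ∘ ι_Δ = ι ∘ ρ^tp`). [claim: Mochizuki2012, status: disputed] -/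
theorem mem_levelTp_iff_of_graphLevels (V : T.I → Subgroup D.graph.Hat)
    (hJhat : ∀ i (y : D.DeltaHat), (y : D.PiHat) ∈ T.Jhat i ↔ D.ρHat y ∈ V i) (i : T.I) (d : D.DeltaTp) :
    d ∈ D.levelTp (T.Jhat i) ↔ D.graph.ι (D.ρTp d) ∈ V i := by
  rw [D.mem_levelTp, ← D.coe_ιΔ d, hJhat, D.ρHat_ιΔ]

/-- **IUTchII:Cor2.4(i)** (kurims p.71 l.1 "the various finite index open subgroups") For an admissible tower whose `V_i`
shrink to `1` in `Π̂_𝔾` (e.g. all open normal subgroups of the profinite `Π̂_𝔾`), the images `ι(ρ^tp(J_i))` shrink to `1` —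
hypothesis `hU` of `StableCurveAgreement.mem_deltaPmBox_of_subgraphLevelData`. PROVED. [claim: Mochizuki2012, status: disputed] -/
theorem images_shrink_of_graphLevels (V : T.I → Subgroup D.graph.Hat)
    (hJhat : ∀ i (y : D.DeltaHat), (y : D.PiHat) ∈ T.Jhat i ↔ D.ρHat y ∈ V i)
    (hV : ∀ O ∈ 𝓝 (1 : D.graph.Hat), ∃ i, (V i : Set D.graph.Hat) ⊆ O) :
    ∀ O ∈ 𝓝 (1 : D.graph.Hat), ∃ i, ∀ d ∈ D.levelTp (T.Jhat i), D.graph.ι (D.ρTp d) ∈ O := by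
  intro O hO
  obtain ⟨i, hi⟩ := hV O hO
  exact ⟨i, fun d hd => hi ((T.mem_levelTp_iff_of_graphLevels V hJhat i d).mp hd)⟩

namespace SubgraphLevelData

variable {T} (L : T.SubgraphLevelData)

/-- **IUTchI:Cor2.3(i)/(ii)** (kurims p.45 l.4–8, p.47) with **[SemiAnbd] Cor 2.7 (i)** proof p.30 — **the dictionary row
B1 (c) from `Π_𝔾`-level statements.**  For an admissible tower (`hJhat`) with open `V_i` (`hVo`): if (D3) an element of
`Δ^tp_X` stabilising `ℍ̃_i` maps into `Π̂_ℍ · V_i` (`hst` — the stabiliser of a component of `p_i⁻¹(ℍ)` under the Galois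
covering `𝔾_i → 𝔾`), and `Π̂_ℍ` lies in the closure of `ι(Π^tp_ℍ)` (`hdense`, the density behind Cor 2.3 (ii)), then
`Stab_{Δ^tp_X}(ℍ̃_i) ⊆ Δ^tp_{X,ℍ} · J_i` (`StabLeDeltaHLevel`): the open set `ĥ·V_i` meets `ι(Π^tp_ℍ)` in some `ι(h)`, and
`h = ρ^tp(k)` for a `k ∈ Δ^tp_{X,ℍ}` (`ρ^tp` surjective) with `k⁻¹γ ∈ J_i`.  PROVED. [claim: Mochizuki2012, status: disputed] -/
theorem stabLeDeltaHLevel_of_graphLevels (V : T.I → Subgroup D.graph.Hat)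
    (hJhat : ∀ i (y : D.DeltaHat), (y : D.PiHat) ∈ T.Jhat i ↔ D.ρHat y ∈ V i)
    (hVo : ∀ i, IsOpen (V i : Set D.graph.Hat))
    (hdense : (D.graph.HatH : Set D.graph.Hat) ⊆ closure ((D.graph.TpH.map D.graph.ι : Subgroup D.graph.Hat) : Set _))
    (hst : ∀ i (γ : D.DeltaTp), (∀ v ∈ L.compH i, L.act i (γ : D.PiTp) v ∈ L.compH i) →
      ∃ ĥ ∈ D.graph.HatH, ĥ⁻¹ * D.graph.ι (D.ρTp γ) ∈ V i) :
    L.StabLeDeltaHLevel := by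
  intro i γ hγ
  obtain ⟨ĥ, hĥ, hĥV⟩ := hst i γ hγ
  -- the open set `ĥ · V_i` meets `ι(Π^tp_ℍ)`
  have hopen : IsOpen ((fun v => ĥ * v) '' (V i : Set D.graph.Hat)) :=
    (Homeomorph.mulLeft ĥ).isOpenMap _ (hVo i)
  have hmem : ĥ ∈ (fun v => ĥ * v) '' (V i : Set D.graph.Hat) := ⟨1, (V i).one_mem, mul_one ĥ⟩
  obtain ⟨_, ⟨v, hv, rfl⟩, ⟨h, hh, hhv⟩⟩ := mem_closure_iff.mp (hdense hĥ) _ hopen hmem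
  -- `h = ρ^tp(k)` with `k ∈ Δ^tp_{X,ℍ}`
  obtain ⟨k, hk⟩ := D.ρTp_surjective h
  refine ⟨k, ?_, ?_⟩
  · show D.ρTp k ∈ D.graph.TpH
    rw [hk]; exact hh
  · rw [T.mem_levelTp_iff_of_graphLevels V hJhat, map_mul, map_inv, map_mul, map_inv, hk, hhv]
    have e : (ĥ * v)⁻¹ * D.graph.ι (D.ρTp γ) = v⁻¹ * (ĥ⁻¹ * D.graph.ι (D.ρTp γ)) := by group
    rw [e]
    exact (V i).mul_mem ((V i).inv_mem hv) hĥV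

end SubgraphLevelData

end Prop24Tower

end StableCurveTemperedData

end Literature.IUT.HodgeTheaters

/-! ## § 2. The closers over an admissible tower -/

namespace Literature.IUT.HodgeArakelov

open Literature.IUT.HodgeTheaters Topology
open Literature.AnabelianGeometry.SemiGraphs (IsProSigma)
open scoped Pointwise

namespace PlusMinusTower

namespace StableCurveAgreement

variable {S : BadPlaceSetting.{u}} {P : TopGroup.{u}} {T : TemperedCoverings S P}
  {W : PlusMinusTower T} {C : CuspidalInertiaData W} {D : StableCurveTemperedData.{u}}

/-- **IUTchII:Cor2.4(i)** (kurims p.70 l.−2 – p.71 l.4) **Inputs (B)+(C) over an ADMISSIBLE tower, with everything except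
Cor 2.3 (v)/(vi) reduced to `Π_𝔾`.**  HYPOTHESES (named, none asserted): the B13 agreement + `Δ`-dictionary of the target
`Π_{v□}`; a tower whose levels are `ρ̂⁻¹(V_i)` for open normal `V_i ⊆ Π̂_𝔾` shrinking to `1` (`hJhat`, `hVn`, `hVo`, `hV`),
realised by coverings of semi-graphs (abc-iut-w4-d076's `CoveringLevelGraphs`) whose level data satisfy [IUTchI] Cor 2.3 (vi)
(`LevelDatum`, `Cor23vi` — BY NAME); (D3) stabilisers (`hst`); density of `Π^tp_ℍ` in `Π̂_ℍ` (`hdense`); `Π̂_ℍ` closed; Cor 2.3 (v);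
levels below `Π̂_v` (`hlevV`), `Π^±_v ∩ Π̂_v ⊆ Π_v` (`hinf`); Def 2.3 (ii)′; the printed hypotheses on `I_t`.  CONCLUSION: for
`γ' ∈ Δ^±_v`, `I^{γ'}_t ⊆ Π^±_{v□} ⟹ γ' ∈ Δ^±_{v□}`.  PROVED (§ 1 + `mem_deltaPmBox_of_coveringLevelGraphs`).
[claim: Mochizuki2012, status: disputed] -/
theorem mem_deltaPmBox_of_graphTower (A : StableCurveAgreement W C D) {H : Subgroup P}
    (Dic : A.SubgraphDictionary H) (Tw : D.Prop24Tower) (V : Tw.I → Subgroup D.graph.Hat)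
    (hJhat : ∀ i (y : D.DeltaHat), (y : D.PiHat) ∈ Tw.Jhat i ↔ D.ρHat y ∈ V i) (hVn : ∀ i, (V i).Normal)
    (hVo : ∀ i, IsOpen (V i : Set D.graph.Hat)) (hV : ∀ O ∈ 𝓝 (1 : D.graph.Hat), ∃ i, (V i : Set D.graph.Hat) ⊆ O)
    (Cv : Tw.CoveringLevelGraphs) (Ad : ∀ i, Cv.toLevelData.LevelDatum i) (h23vi : ∀ i, (Ad i).lev.Cor23vi)
    (hst : ∀ i (γ : D.DeltaTp), (∀ v ∈ Cv.toLevelData.compH i, Cv.toLevelData.act i (γ : D.PiTp) v ∈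
        Cv.toLevelData.compH i) → ∃ ĥ ∈ D.graph.HatH, ĥ⁻¹ * D.graph.ι (D.ρTp γ) ∈ V i)
    (hdense : (D.graph.HatH : Set D.graph.Hat) ⊆ closure ((D.graph.TpH.map D.graph.ι : Subgroup D.graph.Hat) : Set _))
    (hHatH : IsClosed (D.graph.HatH : Set D.graph.Hat)) (h23vD : D.Cor23v)
    (hlevV : ∀ i, Tw.Jhat i ≤ (W.hat.subgroupOf W.pmHat).map A.eHat.toMonoidHom)
    (hinf : W.piPM ⊓ W.hat ≤ W.piV) (hrel' : Def23_ii' C W.piV W.piPM) {I : Subgroup W.Corhat}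
    (hI : C.IsCuspidalInertia W.piV I) (hIΔ : I ≤ W.deltaBox H) :
    ∀ γ' : W.Corhat, γ' ∈ W.piPM ⊓ W.aug.ker →
      I.map (MulAut.conj γ').toMonoidHom ≤ W.pmBox H → γ' ∈ W.deltaPmBox H :=
  A.mem_deltaPmBox_of_coveringLevelGraphs Dic Tw Cv Ad h23vi (Tw.levelsNormal_of_graphLevels V hJhat hVn)
    (Cv.toLevelData.stabLeDeltaHLevel_of_graphLevels V hJhat hVo hdense hst)
    (Tw.images_shrink_of_graphLevels V hJhat hV) hHatH h23vD hlevV hinf hrel' hI hIΔ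

end StableCurveAgreement

end PlusMinusTower

section ClosersGraphTower

open Literature.IUT.HodgeTheaters Topology
open Literature.AnabelianGeometry.SemiGraphs (IsProSigma)

variable {S : BadPlaceSetting.{u}} {P : TopGroup.{u}} {T : TemperedCoverings S P}
  {D : EtaleThetaData S.toThetaSetting P} {Dsc : StableCurveTemperedData.{u}}
  (Dec : SubgraphDecomposition S T D) (W : PlusMinusTower T) (C : CuspidalInertiaData W)
  {L : LabCuspStructure C} (Ld : LabelledDecomposition Dec L) (I : Subgroup W.Corhat)

/-- **IUTchII:Cor2.4(i)′ — closer over an ADMISSIBLE tower** (kurims pp.69–71): the decl of record `Cor24_i' Dec W C Ld I`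
from the agreement `A` with [IUTchI] Prop 2.4 (i), [IUTchII] Def 2.3 (ii)′, `e : I_x ≃ₜ* Ẑ`, `Π^±_v ∩ Π̂_v ⊆ Π_v`, and, per
admissible `Π_{v□}` (`GraphTower`): an [IUTchI] §2 datum `D'` with agreement, `Δ`-dictionary, Cor 2.3 (v), `Π̂_ℍ` closed and
`Π^tp_ℍ` dense in it; a tower `ρ̂⁻¹(V_i)` of open normal `V_i ⊆ Π̂_𝔾` shrinking to `1`, realised by coverings of semi-graphs
whose level data satisfy Cor 2.3 (vi) BY NAME; (D3) stabilisers; levels below `Π̂_v`.  ALL HYPOTHESES; apart from `Cor23v`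
/ `Cor23vi` and the dictionaries, every (B)-side input is a statement about `Π_𝔾`.  PROVED. [claim: Mochizuki2012, status: disputed] -/
theorem cor24_i'_of_graphTower_byName (A : W.StableCurveAgreement C Dsc) (h24i : Dsc.Prop24i)
    (hrel' : Def23_ii' C W.piV W.piPM) (e : ∀ x : Dsc.Cusp, ↥(Dsc.inertiaTp x) ≃ₜ* HodgeTheaters.ZHat)
    (hinf : W.piPM ⊓ W.hat ≤ W.piV)
    (GraphTower : ∀ H : Subgroup P, Cor24_family Dec Ld H →
      ∃ (D' : StableCurveTemperedData.{u}) (A' : W.StableCurveAgreement C D') (_ : A'.SubgraphDictionary H)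
        (_ : D'.Cor23v) (_ : IsClosed (D'.graph.HatH : Set D'.graph.Hat))
        (_ : (D'.graph.HatH : Set D'.graph.Hat) ⊆
          closure ((D'.graph.TpH.map D'.graph.ι : Subgroup D'.graph.Hat) : Set _))
        (Tw : D'.Prop24Tower) (V : Tw.I → Subgroup D'.graph.Hat)
        (_ : ∀ i (y : D'.DeltaHat), (y : D'.PiHat) ∈ Tw.Jhat i ↔ D'.ρHat y ∈ V i) (_ : ∀ i, (V i).Normal)
        (_ : ∀ i, IsOpen (V i : Set D'.graph.Hat))
        (_ : ∀ O ∈ 𝓝 (1 : D'.graph.Hat), ∃ i, (V i : Set D'.graph.Hat) ⊆ O)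
        (Cv : Tw.CoveringLevelGraphs) (Ad : ∀ i, Cv.toLevelData.LevelDatum i),
        (∀ i, (Ad i).lev.Cor23vi) ∧
        (∀ i (γ : D'.DeltaTp), (∀ v ∈ Cv.toLevelData.compH i, Cv.toLevelData.act i (γ : D'.PiTp) v ∈
          Cv.toLevelData.compH i) → ∃ ĥ ∈ D'.graph.HatH, ĥ⁻¹ * D'.graph.ι (D'.ρTp γ) ∈ V i) ∧
        (∀ i, Tw.Jhat i ≤ (W.hat.subgroupOf W.pmHat).map A'.eHat.toMonoidHom)) :
    Literature.IUT.HodgeArakelov.Cor24_i' Dec W C Ld I :=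
  fun H hH => cor24_i_of_inputs_mem W C H I
    (fun hI hIΔ => A.inputA_of_prop24i h24i (hIΔ.trans (inf_le_right : W.deltaBox H ≤ W.aug.ker))
      (A.hΛ_of_equiv_zHat_of_def23ii' hrel' e I hI))
    (fun hI hIΔ => by
      obtain ⟨D', A', hDic, h23vD, hHatH, hdense, Tw, V, hJhat, hVn, hVo, hV, Cv, Ad, h23vi, hst, hlevV⟩ :=
        GraphTower H hH
      exact A'.mem_deltaPmBox_of_graphTower hDic Tw V hJhat hVn hVo hV Cv Ad h23vi hst hdense hHatH h23vD hlevV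
        hinf hrel' hI hIΔ)

/-- **IUTchII:Cor2.4(ii)(iii)′ — closer over an ADMISSIBLE tower** (kurims p.70): the decl of record `Cor24_ii_iii' W C H`
for an admissible `Π_{v□}`, input (B)+(C) supplied per `□'` by `GraphTower` as in `cor24_i'_of_graphTower_byName`; other inputs
(`Prop24i`, `Cor23Hyp`, `Cor23iii`, `hBox`, `Def23_ii'`, `e`, `hinf`, `hcap`, `hYdd`) as in the landed closers — ALL
HYPOTHESES.  PROVED. [claim: Mochizuki2012, status: disputed] -/
theorem cor24_ii_iii'_of_graphTower_byName {H : Subgroup P} (hH : Cor24_family Dec Ld H)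
    (A : W.StableCurveAgreement C Dsc) (h24i : Dsc.Prop24i) (hHyp : Dsc.Cor23Hyp) (h23iii : Dsc.Cor23iii)
    (hrel' : Def23_ii' C W.piV W.piPM) (e : ∀ x : Dsc.Cusp, ↥(Dsc.inertiaTp x) ≃ₜ* HodgeTheaters.ZHat)
    (hinf : W.piPM ⊓ W.hat ≤ W.piV)
    (GraphTower : ∀ H' : Subgroup P, Cor24_family Dec Ld H' →
      ∃ (D' : StableCurveTemperedData.{u}) (A' : W.StableCurveAgreement C D') (_ : A'.SubgraphDictionary H')
        (_ : D'.Cor23v) (_ : IsClosed (D'.graph.HatH : Set D'.graph.Hat))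
        (_ : (D'.graph.HatH : Set D'.graph.Hat) ⊆
          closure ((D'.graph.TpH.map D'.graph.ι : Subgroup D'.graph.Hat) : Set _))
        (Tw : D'.Prop24Tower) (V : Tw.I → Subgroup D'.graph.Hat)
        (_ : ∀ i (y : D'.DeltaHat), (y : D'.PiHat) ∈ Tw.Jhat i ↔ D'.ρHat y ∈ V i) (_ : ∀ i, (V i).Normal)
        (_ : ∀ i, IsOpen (V i : Set D'.graph.Hat))
        (_ : ∀ O ∈ 𝓝 (1 : D'.graph.Hat), ∃ i, (V i : Set D'.graph.Hat) ⊆ O)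
        (Cv : Tw.CoveringLevelGraphs) (Ad : ∀ i, Cv.toLevelData.LevelDatum i),
        (∀ i, (Ad i).lev.Cor23vi) ∧
        (∀ i (γ : D'.DeltaTp), (∀ v ∈ Cv.toLevelData.compH i, Cv.toLevelData.act i (γ : D'.PiTp) v ∈
          Cv.toLevelData.compH i) → ∃ ĥ ∈ D'.graph.HatH, ĥ⁻¹ * D'.graph.ι (D'.ρTp γ) ∈ V i) ∧
        (∀ i, Tw.Jhat i ≤ (W.hat.subgroupOf W.pmHat).map A'.eHat.toMonoidHom))
    (hBox : ((W.pmBox H).subgroupOf W.pmHat).map A.eHat.toMonoidHom = Dsc.piTpXH.map Dsc.ιX)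
    (hcap : W.pmBox H ⊓ W.piV ≤ W.box H)
    (hYdd : ∀ I : Subgroup W.Corhat, C.IsCuspidalInertia W.piV I → I ≤ W.deltaBox H →
      W.cuspDecomp I 1 ≤ (T.YddL).map (W.emb.comp T.incl)) :
    Literature.IUT.HodgeArakelov.Cor24_ii_iii' W C H :=
  cor24_ii_iii'_of_inputs
    (fun I _ _ => cor24_i'_of_graphTower_byName Dec W C Ld I A h24i hrel' e hinf GraphTower H hH)
    (A.boxOntoGalois_of_cor23iii hBox hHyp h23iii) hcap hYdd

end ClosersGraphTower

end Literature.IUT.HodgeArakelov
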